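import Mathlib

/-!
# Linear independence of square roots of square-free products of primes (wall-breaker axis `parabola lifts over finite
fields`, stub `stub_tangencySets` of the crux `LevelOneGL2Designs`, stmt-MatrixMultiplication-14080 — all-primes
trace-zero lift, file 1: the real embedding of a multiquadratic order is injective)

For distinct primes `ℓ₀, …, ℓ_j` the `2^{j+1}` real numbers `√(∏_{i∈S} ℓ_i)`, `S ⊆ {0,…,j}`, are linearly independent
over `ℚ` (Besicovitch 1940; classical).  This is the one arithmetic input of the multiquadratic trace-zero lift
(`IM(2,q) ≳_j q^{3/2 − 2^{−j}}` for ALL primes `q`): it says that the order `ℤ[√ℓ_S : S]` with its explicit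
multiplication table is a domain, which is what turns "the norm determinant vanishes" into "the element vanishes" in the
no-wrap-around step.

Proof (elementary, no Galois theory): with `K(L)` the `ℚ`-span of `{√(∏ S) : S ⊆ L}` for a finite set `L` of primes —
a subring of `ℝ` (`mul_mem`) in which every non-zero element is invertible (`exists_inv`, finite dimension) and with
`K(L ∪ {ℓ}) = K(L) + K(L)√ℓ` (`exists_decomp`) — one shows by induction on `L` that `√m ∉ K(L)` for every square-free
`m ≠ 1` with no prime factor in `L` (`sqrt_notMem`: if `√m = α + β√ℓ` then `2αβ√ℓ ∈ K(L)`, so `αβ = 0`; `β = 0` puts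
`√m` in `K(L)`, `α = 0` puts `√(mℓ)` in `K(L)`; both contradict the induction hypothesis), and then independence by
induction on `L` (`indep_powerset`: a relation `A + B√ℓ = 0` with `A, B ∈ K(L)` forces `B = 0`).  `sqrt_prod_indep`
is the form used downstream (index type `ι`, an injective family of primes).  No definitions, no notation.
-/

-- the summit/problem path `MatrixMultiplication.MatrixMultiplication` is fixed by the tree layout (D-0017)
set_option linter.dupNamespace false

noncomputable section

open Finset

namespace Summit.MatrixMultiplication.MatrixMultiplication.Theorems.LevelOneGL2Designs.SqrtIndep

/-- The products `∏_{p∈S} p` are non-negative reals. [elementary] -/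
theorem prod_nonneg' (S : Finset ℕ) : (0 : ℝ) ≤ ∏ p ∈ S, ((p : ℕ) : ℝ) :=
  Finset.prod_nonneg fun p _ => Nat.cast_nonneg p

/-- `√(∏ p ∈ ∅, (p : ℝ)) = 1`. [elementary] -/
theorem rt_empty : √(∏ p ∈ (∅ : Finset ℕ), (p : ℝ)) = 1 := by simp

/-- Generators lie in the span: `S ⊆ L ⇒ √(∏ p ∈ S, (p : ℝ)) ∈ K(L)`. [elementary] -/
theorem rt_mem {L S : Finset ℕ} (h : S ⊆ L) : √(∏ p ∈ S, (p : ℝ)) ∈ Submodule.span ℚ (Set.range fun S : ↥(Finset.powerset L) => √(∏ p ∈ (S : Finset ℕ), (p : ℝ))) :=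
  Submodule.subset_span ⟨⟨S, mem_powerset.2 h⟩, rfl⟩

/-- `1 ∈ K(L)`. [elementary] -/
theorem one_mem (L : Finset ℕ) : (1 : ℝ) ∈ Submodule.span ℚ (Set.range fun S : ↥(Finset.powerset L) => √(∏ p ∈ (S : Finset ℕ), (p : ℝ))) := by
  have := rt_mem (empty_subset L)
  rwa [rt_empty] at this

/-- Rationals lie in `K(L)`. [elementary] -/
theorem ratCast_mem (L : Finset ℕ) (q : ℚ) : (q : ℝ) ∈ Submodule.span ℚ (Set.range fun S : ↥(Finset.powerset L) => √(∏ p ∈ (S : Finset ℕ), (p : ℝ))) := by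
  have := Submodule.smul_mem (Submodule.span ℚ (Set.range fun S : ↥(Finset.powerset L) => √(∏ p ∈ (S : Finset ℕ), (p : ℝ)))) q (one_mem L)
  simpa using this

/-- **Multiplication table of the square roots**: `√(∏ p ∈ S, (p : ℝ)) · √(∏ p ∈ T, (p : ℝ)) = (∏_{S∩T} p) · √(∏ p ∈ (S ∆ T), (p : ℝ))`. [elementary] -/
theorem rt_mul (S T : Finset ℕ) :
    √(∏ p ∈ S, (p : ℝ)) * √(∏ p ∈ T, (p : ℝ)) = (∏ p ∈ S ∩ T, ((p : ℕ) : ℝ)) * √(∏ p ∈ (symmDiff S T), (p : ℝ)) := by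
  have hST : (∏ p ∈ S, ((p : ℕ) : ℝ)) * ∏ p ∈ T, ((p : ℕ) : ℝ) =
      (∏ p ∈ S ∩ T, ((p : ℕ) : ℝ)) ^ 2 * ∏ p ∈ symmDiff S T, ((p : ℕ) : ℝ) := by
    have hU : S ∪ T = symmDiff S T ∪ S ∩ T := by
      ext p; simp only [Finset.mem_union, Finset.mem_symmDiff, Finset.mem_inter]; tauto
    have hd : Disjoint (symmDiff S T) (S ∩ T) := by
      rw [Finset.disjoint_left]; intro p hp hp'
      rw [Finset.mem_symmDiff] at hp; rw [Finset.mem_inter] at hp'; tauto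
    rw [← Finset.prod_union_inter, hU, Finset.prod_union hd]
    ring
  rw [← Real.sqrt_mul (prod_nonneg' S), hST, Real.sqrt_mul (by positivity), Real.sqrt_sq (prod_nonneg' _)]

/-- `K(L)` is closed under multiplication (the `ℚ`-span of the `√(∏ p ∈ S, (p : ℝ))`, `S ⊆ L`, is a subring of `ℝ`). [elementary] -/
theorem mul_mem {L : Finset ℕ} {x y : ℝ} (hx : x ∈ Submodule.span ℚ (Set.range fun S : ↥(Finset.powerset L) => √(∏ p ∈ (S : Finset ℕ), (p : ℝ)))) (hy : y ∈ Submodule.span ℚ (Set.range fun S : ↥(Finset.powerset L) => √(∏ p ∈ (S : Finset ℕ), (p : ℝ)))) : x * y ∈ Submodule.span ℚ (Set.range fun S : ↥(Finset.powerset L) => √(∏ p ∈ (S : Finset ℕ), (p : ℝ))) := by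
  induction hx using Submodule.span_induction with
  | mem x hxs =>
    obtain ⟨⟨S, hS⟩, rfl⟩ := hxs
    induction hy using Submodule.span_induction with
    | mem y hys =>
      obtain ⟨⟨T, hT⟩, rfl⟩ := hys
      simp only
      rw [rt_mul]
      have hsub : symmDiff S T ⊆ L := by
        intro p hp
        rw [Finset.mem_symmDiff] at hp
        rcases hp with ⟨h1, _⟩ | ⟨h1, _⟩
        · exact (mem_powerset.1 hS) h1
        · exact (mem_powerset.1 hT) h1
      have hq : (∏ p ∈ S ∩ T, ((p : ℕ) : ℝ)) = (((∏ p ∈ S ∩ T, (p : ℚ)) : ℚ) : ℝ) := by push_cast; rfl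
      rw [hq, ← Rat.smul_def]
      exact Submodule.smul_mem _ _ (rt_mem hsub)
    | zero => simp
    | add y z _ _ hy hz => rw [mul_add]; exact Submodule.add_mem _ hy hz
    | smul a y _ hy => rw [mul_smul_comm]; exact Submodule.smul_mem _ _ hy
  | zero => simp
  | add x z _ _ hx hz => rw [add_mul]; exact Submodule.add_mem _ hx hz
  | smul a x _ hx => rw [smul_mul_assoc]; exact Submodule.smul_mem _ _ hx

/-- **Non-zero elements of `K(L)` are invertible in `K(L)`** (`K(L)` is a finite-dimensional `ℚ`-algebra inside the
field `ℝ`, so multiplication by `v ≠ 0` is an injective, hence surjective, endomorphism). [elementary] -/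
theorem exists_inv {L : Finset ℕ} {v : ℝ} (hv : v ∈ Submodule.span ℚ (Set.range fun S : ↥(Finset.powerset L) => √(∏ p ∈ (S : Finset ℕ), (p : ℝ)))) (hv0 : v ≠ 0) : ∃ w ∈ Submodule.span ℚ (Set.range fun S : ↥(Finset.powerset L) => √(∏ p ∈ (S : Finset ℕ), (p : ℝ))), v * w = 1 := by
  haveI : FiniteDimensional ℚ (Submodule.span ℚ (Set.range fun S : ↥(Finset.powerset L) => √(∏ p ∈ (S : Finset ℕ), (p : ℝ)))) := FiniteDimensional.span_of_finite ℚ (Set.finite_range _)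
  let f : (Submodule.span ℚ (Set.range fun S : ↥(Finset.powerset L) => √(∏ p ∈ (S : Finset ℕ), (p : ℝ)))) →ₗ[ℚ] (Submodule.span ℚ (Set.range fun S : ↥(Finset.powerset L) => √(∏ p ∈ (S : Finset ℕ), (p : ℝ)))) :=
    { toFun := fun w => ⟨v * w, mul_mem hv w.2⟩
      map_add' := fun a b => by ext; simp [mul_add]
      map_smul' := fun a b => by ext; simp }
  have hinj : Function.Injective f := by
    intro a b hab
    have : v * a = v * b := congrArg Subtype.val hab
    exact Subtype.ext (mul_left_cancel₀ hv0 this)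
  obtain ⟨w, hw⟩ := (LinearMap.injective_iff_surjective.1 hinj) ⟨1, one_mem L⟩
  exact ⟨w, w.2, congrArg Subtype.val hw⟩

/-- **Adjoining one more prime**: every element of `K(L₀ ∪ {ℓ})` is `α + β√ℓ` with `α, β ∈ K(L₀)`.
[elementary] -/
theorem exists_decomp {L₀ : Finset ℕ} {ℓ : ℕ} {x : ℝ} (hx : x ∈ Submodule.span ℚ (Set.range fun S : ↥(Finset.powerset (insert ℓ L₀)) => √(∏ p ∈ (S : Finset ℕ), (p : ℝ)))) :
    ∃ α ∈ Submodule.span ℚ (Set.range fun S : ↥(Finset.powerset L₀) => √(∏ p ∈ (S : Finset ℕ), (p : ℝ))), ∃ β ∈ Submodule.span ℚ (Set.range fun S : ↥(Finset.powerset L₀) => √(∏ p ∈ (S : Finset ℕ), (p : ℝ))), x = α + β * Real.sqrt ℓ := by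
  induction hx using Submodule.span_induction with
  | mem x hxs =>
    obtain ⟨⟨S, hS⟩, rfl⟩ := hxs
    simp only
    by_cases hS' : ℓ ∈ S
    · -- `S = insert ℓ (S.erase ℓ)` and `√(∏ p ∈ S, (p : ℝ)) = √ℓ · √(∏ p ∈ (S.erase ℓ), (p : ℝ))`
      have hsub : S.erase ℓ ⊆ L₀ := by
        intro p hp
        rcases Finset.mem_insert.1 ((mem_powerset.1 hS) (Finset.mem_of_mem_erase hp)) with h | h
        · exact absurd h (Finset.ne_of_mem_erase hp)
        · exact h
      refine ⟨0, Submodule.zero_mem _, √(∏ p ∈ (S.erase ℓ), (p : ℝ)), rt_mem hsub, ?_⟩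
      conv_lhs => rw [← Finset.insert_erase hS']
      rw [Finset.prod_insert (Finset.notMem_erase ℓ S), Real.sqrt_mul (Nat.cast_nonneg ℓ)]
      ring
    · have hsub : S ⊆ L₀ := by
        intro p hp
        have := (mem_powerset.1 hS) hp
        rcases Finset.mem_insert.1 this with h | h
        · exact absurd (h ▸ hp) hS'
        · exact h
      exact ⟨√(∏ p ∈ S, (p : ℝ)), rt_mem hsub, 0, Submodule.zero_mem _, by ring⟩
  | zero => exact ⟨0, Submodule.zero_mem _, 0, Submodule.zero_mem _, by ring⟩
  | add x y _ _ hx hy =>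
    obtain ⟨α, hα, β, hβ, rfl⟩ := hx; obtain ⟨α', hα', β', hβ', rfl⟩ := hy
    exact ⟨α + α', Submodule.add_mem _ hα hα', β + β', Submodule.add_mem _ hβ hβ', by ring⟩
  | smul a x _ hx =>
    obtain ⟨α, hα, β, hβ, rfl⟩ := hx
    refine ⟨a • α, Submodule.smul_mem _ _ hα, a • β, Submodule.smul_mem _ _ hβ, ?_⟩
    rw [Rat.smul_def, Rat.smul_def, Rat.smul_def]
    ring

/-- Elements of `K(∅)` are rational. [elementary] -/
theorem mem_KK_empty {x : ℝ} (hx : x ∈ Submodule.span ℚ (Set.range fun S : ↥(Finset.powerset (∅ : Finset ℕ)) => √(∏ p ∈ (S : Finset ℕ), (p : ℝ)))) : ∃ q : ℚ, x = q := by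
  induction hx using Submodule.span_induction with
  | mem x hxs =>
    obtain ⟨⟨S, hS⟩, rfl⟩ := hxs
    have hS' := hS
    rw [Finset.powerset_empty, Finset.mem_singleton] at hS'
    subst hS'
    exact ⟨1, by simp⟩
  | zero => exact ⟨0, by simp⟩
  | add x y _ _ hx hy =>
    obtain ⟨a, rfl⟩ := hx; obtain ⟨b, rfl⟩ := hy; exact ⟨a + b, by push_cast; ring⟩
  | smul a x _ hx =>
    obtain ⟨b, rfl⟩ := hx
    exact ⟨a * b, by rw [Rat.smul_def]; push_cast; ring⟩

/-- A square-free natural number `≠ 1` is not a perfect square. [elementary] -/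
theorem not_isSquare_of_squarefree {m : ℕ} (hm : Squarefree m) (hm1 : m ≠ 1) : ¬ IsSquare m := by
  rintro ⟨r, hr⟩
  have hunit : IsUnit r := hm r ⟨1, by rw [hr, mul_one]⟩
  rw [Nat.isUnit_iff] at hunit
  subst hunit
  exact hm1 (by simpa using hr)

/-- **`√m ∉ K(L)`** for `m` square-free, `m ≠ 1`, with no prime factor in the set of primes `L` — by induction on
`L`: writing `√m = α + β√ℓ` over `K(L₀)` (`L = L₀ ∪ {ℓ}`), squaring gives `2αβ√ℓ ∈ K(L₀)`, whence `αβ = 0` since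
`√ℓ ∉ K(L₀)`; `β = 0` contradicts `√m ∉ K(L₀)` and `α = 0` contradicts `√(mℓ) ∉ K(L₀)`. [classical, Besicovitch 1940] -/
theorem sqrt_notMem : ∀ (L : Finset ℕ), (∀ p ∈ L, p.Prime) → ∀ m : ℕ, Squarefree m → m ≠ 1 →
    (∀ p ∈ L, ¬ p ∣ m) → Real.sqrt (m : ℝ) ∉ Submodule.span ℚ (Set.range fun S : ↥(Finset.powerset L) => √(∏ p ∈ (S : Finset ℕ), (p : ℝ))) := by
  intro L
  induction L using Finset.induction_on with
  | empty =>
    intro _ m hm hm1 _ hmem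
    obtain ⟨q, hq⟩ := mem_KK_empty hmem
    have hirr : Irrational (Real.sqrt (m : ℝ)) :=
      irrational_sqrt_natCast_iff.2 (not_isSquare_of_squarefree hm hm1)
    exact hirr.ne_rat q hq
  | insert ℓ L₀ hℓ ih =>
    intro hprime m hm hm1 hdiv hmem
    have hℓp : ℓ.Prime := hprime ℓ (Finset.mem_insert_self ℓ L₀)
    have hprime₀ : ∀ p ∈ L₀, p.Prime := fun p hp => hprime p (Finset.mem_insert_of_mem hp)
    have hdiv₀ : ∀ p ∈ L₀, ¬ p ∣ m := fun p hp => hdiv p (Finset.mem_insert_of_mem hp)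
    have hℓm : ¬ ℓ ∣ m := hdiv ℓ (Finset.mem_insert_self ℓ L₀)
    -- `√ℓ ∉ K(L₀)`
    have hℓnot : Real.sqrt (ℓ : ℝ) ∉ Submodule.span ℚ (Set.range fun S : ↥(Finset.powerset L₀) => √(∏ p ∈ (S : Finset ℕ), (p : ℝ))) := by
      refine ih hprime₀ ℓ hℓp.squarefree hℓp.one_lt.ne' fun p hp hpd => ?_
      have : p = ℓ := (Nat.prime_dvd_prime_iff_eq (hprime₀ p hp) hℓp).1 hpd
      exact hℓ (this ▸ hp)
    obtain ⟨α, hα, β, hβ, e⟩ := exists_decomp hmem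
    have h1 : Real.sqrt (m : ℝ) ^ 2 = m := Real.sq_sqrt (Nat.cast_nonneg m)
    have h2 : Real.sqrt (ℓ : ℝ) ^ 2 = ℓ := Real.sq_sqrt (Nat.cast_nonneg ℓ)
    -- squaring: `2αβ √ℓ = m - α² - β² ℓ ∈ K(L₀)`
    have hkey : (2 * α * β) * Real.sqrt ℓ = (m : ℝ) - α ^ 2 - β ^ 2 * ℓ := by
      have e2 : Real.sqrt (m : ℝ) ^ 2 = (α + β * Real.sqrt ℓ) ^ 2 := by rw [e]
      rw [h1] at e2
      linear_combination -e2 - β ^ 2 * h2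
    have hk : (2 * α * β) * Real.sqrt ℓ ∈ Submodule.span ℚ (Set.range fun S : ↥(Finset.powerset L₀) => √(∏ p ∈ (S : Finset ℕ), (p : ℝ))) := by
      rw [hkey]
      refine Submodule.sub_mem _ (Submodule.sub_mem _ ?_ ?_) ?_
      · simpa using ratCast_mem L₀ (m : ℚ)
      · rw [sq]; exact mul_mem hα hα
      · have : β ^ 2 * (ℓ : ℝ) = β * β * ((ℓ : ℚ) : ℝ) := by push_cast; ring
        rw [this]
        exact mul_mem (mul_mem hβ hβ) (ratCast_mem L₀ _)
    have h2ab : 2 * α * β ∈ Submodule.span ℚ (Set.range fun S : ↥(Finset.powerset L₀) => √(∏ p ∈ (S : Finset ℕ), (p : ℝ))) := by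
      have : (2 : ℝ) * α * β = ((2 : ℚ) : ℝ) * α * β := by push_cast; ring
      rw [this]
      exact mul_mem (mul_mem (ratCast_mem L₀ 2) hα) hβ
    have hαβ : 2 * α * β = 0 := by
      by_contra hne
      obtain ⟨w, hw, hww⟩ := exists_inv h2ab hne
      apply hℓnot
      have : Real.sqrt (ℓ : ℝ) = w * ((2 * α * β) * Real.sqrt ℓ) := by
        calc Real.sqrt (ℓ : ℝ) = (2 * α * β * w) * Real.sqrt ℓ := by rw [hww, one_mul]
          _ = w * ((2 * α * β) * Real.sqrt ℓ) := by ring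
      rw [this]
      exact mul_mem hw hk
    have hαβ' : α = 0 ∨ β = 0 := by simpa using hαβ
    rcases hαβ' with hα0 | hβ0
    · -- `√m = β √ℓ`, so `√(m ℓ) = β ℓ ∈ K(L₀)`
      subst hα0
      rw [zero_add] at e
      have hmℓ : Real.sqrt ((m * ℓ : ℕ) : ℝ) ∈ Submodule.span ℚ (Set.range fun S : ↥(Finset.powerset L₀) => √(∏ p ∈ (S : Finset ℕ), (p : ℝ))) := by
        have : Real.sqrt ((m * ℓ : ℕ) : ℝ) = β * ((ℓ : ℚ) : ℝ) := by
          push_cast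
          rw [Real.sqrt_mul (Nat.cast_nonneg m), e]
          calc β * Real.sqrt ℓ * Real.sqrt ℓ = β * (Real.sqrt (ℓ : ℝ) ^ 2) := by ring
            _ = β * ℓ := by rw [h2]
        rw [this]
        exact mul_mem hβ (ratCast_mem L₀ _)
      have hcop : Nat.Coprime m ℓ := ((Nat.Prime.coprime_iff_not_dvd hℓp).2 hℓm).symm
      refine ih hprime₀ (m * ℓ) ((Nat.squarefree_mul hcop).2 ⟨hm, hℓp.squarefree⟩) ?_ ?_ hmℓ
      · intro h
        have := Nat.eq_one_of_mul_eq_one_left h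
        exact hℓp.one_lt.ne' this
      · intro p hp hpd
        rcases (Nat.Prime.dvd_mul (hprime₀ p hp)).1 hpd with h | h
        · exact hdiv₀ p hp h
        · have : p = ℓ := (Nat.prime_dvd_prime_iff_eq (hprime₀ p hp) hℓp).1 h
          exact hℓ (this ▸ hp)
    · -- `√m = α ∈ K(L₀)`
      subst hβ0
      rw [zero_mul, add_zero] at e
      exact ih hprime₀ m hm hm1 hdiv₀ (e ▸ hα)

/-- `√(∏ p ∈ (insert ℓ S), (p : ℝ)) = √ℓ · √(∏ p ∈ S, (p : ℝ))` for `ℓ ∉ S`. [elementary] -/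
theorem rt_insert {ℓ : ℕ} {S : Finset ℕ} (h : ℓ ∉ S) :
    √(∏ p ∈ (insert ℓ S), (p : ℝ)) = Real.sqrt ℓ * √(∏ p ∈ S, (p : ℝ)) := by
  rw [Finset.prod_insert h, Real.sqrt_mul (Nat.cast_nonneg ℓ)]

/-- **Independence over a set of primes**: if `∑_{S ⊆ L} c_S · √(∏ p ∈ S, (p : ℝ)) = 0` with rational `c_S` then all `c_S = 0`
(induction on `L`, splitting `S` by membership of the new prime `ℓ`: a relation `A + √ℓ·B = 0` over `K(L₀)` forces
`B = 0` by `sqrt_notMem`). [classical, Besicovitch 1940] -/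
theorem indep_powerset : ∀ (L : Finset ℕ), (∀ p ∈ L, p.Prime) → ∀ c : Finset ℕ → ℚ,
    (∑ S ∈ L.powerset, (c S : ℝ) * √(∏ p ∈ S, (p : ℝ))) = 0 → ∀ S ∈ L.powerset, c S = 0 := by
  intro L
  induction L using Finset.induction_on with
  | empty =>
    intro _ c hc S hS
    rw [Finset.powerset_empty, Finset.sum_singleton, rt_empty, mul_one] at hc
    rw [Finset.powerset_empty, Finset.mem_singleton] at hS
    subst hS
    exact_mod_cast hc
  | insert ℓ L₀ hℓ ih =>
    intro hprime c hc
    have hℓp : ℓ.Prime := hprime ℓ (Finset.mem_insert_self ℓ L₀)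
    have hprime₀ : ∀ p ∈ L₀, p.Prime := fun p hp => hprime p (Finset.mem_insert_of_mem hp)
    have hℓnot : Real.sqrt (ℓ : ℝ) ∉ Submodule.span ℚ (Set.range fun S : ↥(Finset.powerset L₀) => √(∏ p ∈ (S : Finset ℕ), (p : ℝ))) := by
      refine sqrt_notMem L₀ hprime₀ ℓ hℓp.squarefree hℓp.one_lt.ne' fun p hp hpd => ?_
      have : p = ℓ := (Nat.prime_dvd_prime_iff_eq (hprime₀ p hp) hℓp).1 hpd
      exact hℓ (this ▸ hp)
    -- split the sum over `S ⊆ L₀ ∪ {ℓ}` into `S ⊆ L₀` and `S = insert ℓ T`, `T ⊆ L₀`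
    have hdisj : Disjoint L₀.powerset (L₀.powerset.image (insert ℓ)) := by
      rw [Finset.disjoint_left]
      intro S hS hS'
      obtain ⟨T, _, rfl⟩ := Finset.mem_image.1 hS'
      exact hℓ ((mem_powerset.1 hS) (Finset.mem_insert_self ℓ T))
    have hinj : Set.InjOn (fun S : Finset ℕ => insert ℓ S) (↑L₀.powerset : Set (Finset ℕ)) := by
      intro S hS T hT hST
      have hS' : ℓ ∉ S := fun h => hℓ ((mem_powerset.1 hS) h)
      have hT' : ℓ ∉ T := fun h => hℓ ((mem_powerset.1 hT) h)
      have hST' : insert ℓ S = insert ℓ T := hST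
      rw [← Finset.erase_insert hS', hST', Finset.erase_insert hT']
    rw [Finset.powerset_insert, Finset.sum_union hdisj, Finset.sum_image hinj] at hc
    set A := ∑ S ∈ L₀.powerset, (c S : ℝ) * √(∏ p ∈ S, (p : ℝ)) with hA
    set B := ∑ S ∈ L₀.powerset, (c (insert ℓ S) : ℝ) * √(∏ p ∈ S, (p : ℝ)) with hB
    have hsum2 : ∑ S ∈ L₀.powerset, (c (insert ℓ S) : ℝ) * √(∏ p ∈ (insert ℓ S), (p : ℝ)) = Real.sqrt ℓ * B := by
      rw [hB, Finset.mul_sum]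
      refine Finset.sum_congr rfl fun S hS => ?_
      have hS' : ℓ ∉ S := fun h => hℓ ((mem_powerset.1 hS) h)
      rw [rt_insert hS']
      ring
    rw [hsum2] at hc
    have hAmem : A ∈ Submodule.span ℚ (Set.range fun S : ↥(Finset.powerset L₀) => √(∏ p ∈ (S : Finset ℕ), (p : ℝ))) := by
      refine Submodule.sum_mem _ fun S hS => ?_
      rw [← Rat.smul_def]
      exact Submodule.smul_mem _ _ (rt_mem (mem_powerset.1 hS))
    have hBmem : B ∈ Submodule.span ℚ (Set.range fun S : ↥(Finset.powerset L₀) => √(∏ p ∈ (S : Finset ℕ), (p : ℝ))) := by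
      refine Submodule.sum_mem _ fun S hS => ?_
      rw [← Rat.smul_def]
      exact Submodule.smul_mem _ _ (rt_mem (mem_powerset.1 hS))
    have hB0 : B = 0 := by
      by_contra hne
      obtain ⟨w, hw, hww⟩ := exists_inv hBmem hne
      apply hℓnot
      have : Real.sqrt (ℓ : ℝ) = -(A * w) := by
        have : Real.sqrt (ℓ : ℝ) * B = -A := by linarith
        calc Real.sqrt (ℓ : ℝ) = Real.sqrt ℓ * (B * w) := by rw [hww, mul_one]
          _ = (Real.sqrt ℓ * B) * w := by ring
          _ = -(A * w) := by rw [this]; ring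
      rw [this]
      exact Submodule.neg_mem _ (mul_mem hAmem hw)
    have hA0 : A = 0 := by rw [hB0, mul_zero, add_zero] at hc; exact hc
    have ihA := ih hprime₀ c hA0
    have ihB := ih hprime₀ (fun S => c (insert ℓ S)) hB0
    intro S hS
    rw [Finset.powerset_insert, Finset.mem_union] at hS
    rcases hS with hS | hS
    · exact ihA S hS
    · obtain ⟨T, hT, rfl⟩ := Finset.mem_image.1 hS
      exact ihB T hT

/-- **Linear independence of `√(∏_{i∈S} ℓ_i)`, `S ⊆ ι`, over `ℚ`** for an injective family of primes `ℓ : ι → ℕ`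
(the form used by the multiquadratic lift). [classical, Besicovitch 1940] -/
theorem sqrt_prod_indep {ι : Type*} [Fintype ι] [DecidableEq ι] (ℓ : ι → ℕ) (hprime : ∀ i, (ℓ i).Prime)
    (hinj : Function.Injective ℓ) (c : Finset ι → ℚ)
    (h : (∑ S : Finset ι, (c S : ℝ) * Real.sqrt (∏ i ∈ S, ((ℓ i : ℕ) : ℝ))) = 0) : c = 0 := by
  classical
  set L : Finset ℕ := Finset.univ.image ℓ with hL
  -- the coefficient of `T ⊆ L` is `c` of its preimage
  let pre : Finset ℕ → Finset ι := fun T => Finset.univ.filter fun i => ℓ i ∈ T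
  have hpre : ∀ S : Finset ι, pre (S.image ℓ) = S := by
    intro S
    ext i
    simp only [pre, Finset.mem_filter, Finset.mem_univ, true_and, Finset.mem_image]
    constructor
    · rintro ⟨j, hj, hji⟩; exact hinj hji ▸ hj
    · intro hi; exact ⟨i, hi, rfl⟩
  have hprimeL : ∀ p ∈ L, p.Prime := by
    intro p hp
    obtain ⟨i, _, rfl⟩ := Finset.mem_image.1 hp
    exact hprime i
  -- `L.powerset` is the image of `S ↦ S.image ℓ`
  have hpow : L.powerset = (Finset.univ : Finset (Finset ι)).image (fun S => S.image ℓ) := by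
    ext T
    simp only [Finset.mem_powerset, Finset.mem_image, Finset.mem_univ, true_and]
    constructor
    · intro hT
      refine ⟨pre T, ?_⟩
      ext p
      simp only [Finset.mem_image, pre, Finset.mem_filter, Finset.mem_univ, true_and]
      constructor
      · rintro ⟨i, hi, rfl⟩; exact hi
      · intro hp
        obtain ⟨i, _, rfl⟩ := Finset.mem_image.1 (hT hp)
        exact ⟨i, hp, rfl⟩
    · rintro ⟨S, rfl⟩
      exact Finset.image_subset_image (Finset.subset_univ S)
  have hinj' : Set.InjOn (fun S : Finset ι => S.image ℓ) ↑(Finset.univ : Finset (Finset ι)) :=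
    fun S _ T _ hST => Finset.image_injective hinj hST
  have key := indep_powerset L hprimeL (fun T => c (pre T)) (by
    rw [hpow, Finset.sum_image hinj']
    rw [← h]
    refine Finset.sum_congr rfl fun S _ => ?_
    rw [hpre S, Finset.prod_image fun i _ j _ hij => hinj hij])
  funext S
  show c S = 0
  have := key (S.image ℓ) (by
    rw [Finset.mem_powerset]
    exact Finset.image_subset_image (Finset.subset_univ S))
  simpa only [hpre S] using this

/-- Integer-coefficient form of `sqrt_prod_indep`. [classical, Besicovitch 1940] -/
theorem sqrt_prod_indep_int {ι : Type*} [Fintype ι] [DecidableEq ι] (ℓ : ι → ℕ) (hprime : ∀ i, (ℓ i).Prime)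
    (hinj : Function.Injective ℓ) (c : Finset ι → ℤ)
    (h : (∑ S : Finset ι, (c S : ℝ) * Real.sqrt (∏ i ∈ S, ((ℓ i : ℕ) : ℝ))) = 0) : c = 0 := by
  have := sqrt_prod_indep ℓ hprime hinj (fun S => (c S : ℚ)) (by push_cast; exact h)
  funext S
  show c S = 0
  have := congrFun this S
  simp only [Pi.zero_apply] at this
  exact_mod_cast this

end Summit.MatrixMultiplication.MatrixMultiplication.Theorems.LevelOneGL2Designs.SqrtIndep
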